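import Summits.QuantumFields.BalabanUV.T4Continuum.Spine.NE7cSmoothing
import Literature.MathematicalPhysics.QuantumFieldTheory.Balaban1983to89.T4LipschitzLedgerSocket

/-!
# T⁴ programme, spine node NE7c (U5b) — ROAD P3 «SMOOTHING»: END-R PLUGGED INTO THE SEAM-(ζ′) TAIL SOCKET (SOCKET-FIT, kernel)

Cell `pub-balaban`, BINDER-OWNERS row NE7c, co-owner #3 = unit `b2b-balaban-t4-ne7c-p3` (GEN 2), skeleton
`HOME/t4/skeletons/NE7c-t4-ne7c-p3.md` §1 / §5(a).  Companion of `Spine/NE7cSmoothing` (p206673).  The row's root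
`T4IndicatorShell.ShellWeightBound` is consumed, together with row NE7b's `RelWeightBound`, by the seam-(ζ′) socket
`T4MatchingClosureSocket.hybridNE7_closure'_tail` (pv02), which finds the tail `K ≥ K₀` on which `W K + Wsh K < 1` from the two
`summable` fields and returns node U5's datum `T4MatchingAssembly.HybridNE7` for the `K₀`-shifted families.  THIS MODULE is the
FLIP-ROUTE twin of `T4LipschitzLedgerSocket.hybridNE7_tail_of_localRate_towers` (tower route, t4-ne7c-p2 / pv07): road P3's END-R
`NE7cSmoothing.shellWeightBound_patterned_of_localRate` placed in the socket's NE7c slot, so that the (η)-layer of the two runs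
meets ONE binder list and ONE conclusion, with NO weight condition, NO `SiblingSuppression`, NO `TowerBound`, NO floor:
* `hybridNE7_tail_patterned_of_localRate` — binders: END-R's (profiles / data / node U1b's `LocalRate` through `ReadsLevels` and a
  threshold floor / older weights), row NE7b's `RelWeightBound` ON THE LAYER, a `ReindexedBudget` on the layer's hybrid cores
  `A − shA`, `B − shB` (node U5b's factor ledger `hsw` + NE-R1's `ν`, `u`, `s₂` — the socket's own typing), four summable rates
  ⇒ `∃ K₀, HybridNE7 …` for the shifted layer families with shell weight `K ↦ Σ_{a≤N₀} n a·lipWeight Lχ 2 (geomWidth C θmin ϑ) a (K₀+K)`.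
* `hybridNE7_tail_patterned_of_localRate_fixW` — the same with row NE7b's datum given where NE7b produces it: at the OLDER level,
  on the FIXED-BLOCK weights `fixW` of the older histories (as in pv07's `T4PatternLayer.cauchy_of_finest_patterned`), transported
  to the layer's class «older history bad, any pattern» by neutrality (`relWeightBound_layer₂`, `sum_layerOver_layerX₂`).
* `termRepr_window_layer_A` / `_B` — the two runs' WINDOW REPRESENTATIONS of the layer (`T4LipschitzLedger.TermRepr` on the common
  `K`-free window spaces; the objects the (o1) instantiation seat and node U5b's `core_sandwich` read), exposed by name; and
  `hybridNE7_tail_patterned_of_localRate_coreW` — END-S with the budget held on the ledger's COMMON MIN-CORES `coreW` (node U5b's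
  natural object: `hsw` acts on the min-core integrand against the two old densities), transported to the socket's hybrid cores by
  `T4LipschitzLedgerSocket.reindexedBudget_of_coreW`.
Every theorem is a composition BY NAME; nothing is re-proved; 0 sorry; [folklore].

HONEST FRAMING.  SOCKET-FIT only: no binder is discharged here beyond what END-R discharges; `LocalRate` is spine estimate NE3
(NOT PRINTED), `RelWeightBound` is row NE7b, the `ReindexedBudget` is node U5b's/NE-R1's, the (o1) instantiation of the layer
data for Bałaban's runs is NODE O (pv07) — all binders, nothing of Bałaban's asserted.  FIXED finite T⁴, rung (B)+1; NOT infinite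
volume, NOT a mass gap, NOT Clay, NOT summit progress; spine 0/9.  HONEST DEPENDENCY: continuum YM on T⁴ ⇐ BetaPertH ∧ nine
spine estimates (0/9 proved); BetaPertH ⇐ (D1) ∧ (D4) ∧ CAP+tail; G-an2-4 gates asym, D1 and NE2/3/4.
-/

noncomputable section

open MeasureTheory Finset Filter
open scoped NNReal ENNReal

namespace Summit.QuantumFields.BalabanUV.T4Continuum.NE7cSmoothingSocket

open Literature.MathematicalPhysics.QuantumFieldTheory.Balaban1983to89
open T4Continuum T4LevelShift T4AveragingDisintegration T4WindowLevelShift T4LipschitzLedger T4FiniteEpsInhabited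
  BlockAveraging ExpMeanLog T4FinestToWindow T4AgeZeroLayer T4PatternLayer T4SupCloseLiaison T4EtaRateMin
open T4IndicatorShell T4LipschitzCutoff T4WeightBudget T4HybridMatching T4MatchingAssembly T4MatchingClosure
  T4MatchingClosureSocket T4LipschitzLedgerSocket
open Summit.QuantumFields.BalabanUV.T4Continuum.NE7cSmoothing

variable {ι₀ Dat Sit : Type*} [DecidableEq ι₀] {N : ℕ} [NeZero N] (F : T4Family)

/-- **END-S — ROAD P3 THROUGH THE SEAM-(ζ′) TAIL SOCKET.**  END-R's binders (profiles `hχ`; data `hNW`/`hwin`/`hband`/`hinj`;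
threshold floor `hmin`/`hθf`; measurable window functionals `hvm`; node U1b's `LocalRate` with `ReadsLevels`; older weights), row
NE7b's `RelWeightBound` on the layer families, a `ReindexedBudget` on the layer's hybrid cores, four summable rates ⇒ an origin
`K₀` and node U5's `HybridNE7` datum for the `K₀`-shifted (η)-layer of the two runs — NO `lt_one` hypothesis (the socket finds the
tail), NO sibling-suppression or tower binder (the flip involution, inside END-W). [folklore] -/
theorem hybridNE7_tail_patterned_of_localRate {l₀ vol : ℝ} {T₀ : ℕ → Finset ι₀} {R : Readings Dat Sit} {C ϑ θmin : ℝ}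
    {χ : ℕ → ℝ → ℝ} {κ Lχ : ℕ → ℝ} (hχ : ∀ a, LipProfile (χ a) (κ a) (Lχ a)) {N₀ : ℕ} {n : ℕ → ℕ}
    {NW₀ : ι₀ → ℕ} (hNW : ∀ K, ∀ τ' ∈ T₀ K, NW₀ τ' ≤ K) {m₀ : ℕ → ι₀ → ℕ} {slot₀ : ℕ → ι₀ → ℕ → Σ _ : ℕ, ℕ}
    (hwin : ∀ K, ∀ τ' ∈ T₀ K, ∀ i < m₀ K τ', slot₀ K τ' i ∈ (range (N₀ + 1)).sigma fun a => range (n a))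
    (hband : ∀ K, ∀ τ' ∈ T₀ K, ∀ i < m₀ K τ', (slot₀ K τ' i).1 ≤ K)
    (hinj : ∀ K, ∀ τ' ∈ T₀ K, ∀ j < m₀ K τ', ∀ j' < m₀ K τ', slot₀ K τ' j = slot₀ K τ' j' → j = j')
    {fpol : ℕ → ι₀ → ℕ → Pol} {θ₀ : ℕ → ι₀ → ℕ → ℝ} (hmin : 0 < θmin) (hθf : ThresholdFloor T₀ m₀ θ₀ θmin)
    {vA vB : (K : ℕ) → (τ' : ι₀) → ℕ → GaugeField (F.P (NW₀ τ')) 0 (SU N) → ℝ}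
    (hvm : ∀ K, ∀ τ' ∈ T₀ K, ∀ i < m₀ K τ', Measurable (vA K τ' i) ∧ Measurable (vB K τ' i))
    (hloc : LocalRate R C ϑ) (hC : 0 ≤ C) (hϑ0 : 0 ≤ ϑ) (hϑ1 : ϑ < 1)
    (hR : ReadsLevels R T₀ (fun _ τ' => fieldMeasure (F.P (NW₀ τ')) 0 (SU N)) m₀ slot₀ vA vB)
    {RA : (K : ℕ) → ℝ → ι₀ → GaugeField (F.P K) 0 (SU N) → ℝ}
    {RB : (K : ℕ) → ℝ → ι₀ → GaugeField (F.P (K + 1)) 0 (SU N) → ℝ}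
    (hRA0 : ∀ K t, |t| ≤ l₀ → ∀ τ' ∈ T₀ K, 0 ≤ᵐ[fieldMeasure (F.P K) 0 (SU N)] RA K t τ')
    (hRAi : ∀ K t, |t| ≤ l₀ → ∀ τ' ∈ T₀ K, Integrable (RA K t τ') (fieldMeasure (F.P K) 0 (SU N)))
    (hRB0 : ∀ K t, |t| ≤ l₀ → ∀ τ' ∈ T₀ K, 0 ≤ᵐ[fieldMeasure (F.P (K + 1)) 0 (SU N)] RB K t τ')
    (hRBi : ∀ K t, |t| ≤ l₀ → ∀ τ' ∈ T₀ K, Integrable (RB K t τ') (fieldMeasure (F.P (K + 1)) 0 (SU N)))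
    {Bad : ℕ → ℝ → Finset (ι₀ × Finset ℕ)} {W : ℕ → ℝ}
    (hW : RelWeightBound l₀ (layerT₂ T₀ m₀) (layerX₂ F χ NW₀ m₀ m₀ slot₀ fpol θ₀ vA (fun K => K) RA)
      (layerX₂ F χ NW₀ m₀ m₀ slot₀ fpol θ₀ vB (fun K => K + 1) RB) Bad W)
    {Cc Rr CcRec RrRec : ℕ → ℝ → ι₀ × Finset ℕ → ℝ} {ν u s₂ c₀ r s : ℕ → ℝ}
    (hTB : ReindexedBudget l₀ vol (layerT₂ T₀ m₀)
      (fun K t τ => layerX₂ F χ NW₀ m₀ m₀ slot₀ fpol θ₀ vA (fun K => K) RA K t τ -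
        shellW χ (fun _ τ => fieldMeasure (F.P (NW₀ τ.1)) 0 (SU N)) (layerM₂ m₀) (layerSlot₂ slot₀) (layerPol₂ m₀ fpol)
          (layerThr θ₀) (layerVar₂ vA) (layerVar₂ vB)
          (fun K t τ V => (oldDensity F (expMeanLogSU : LoopAverage (SU N)) K (NW₀ τ.1) (layerRem RA K t τ) V : ℝ)) K t τ)
      (fun K t τ => layerX₂ F χ NW₀ m₀ m₀ slot₀ fpol θ₀ vB (fun K => K + 1) RB K t τ -
        shellW χ (fun _ τ => fieldMeasure (F.P (NW₀ τ.1)) 0 (SU N)) (layerM₂ m₀) (layerSlot₂ slot₀) (layerPol₂ m₀ fpol)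
          (layerThr θ₀) (layerVar₂ vB) (layerVar₂ vA)
          (fun K t τ V => (oldDensity F (expMeanLogSU : LoopAverage (SU N)) (K + 1) (NW₀ τ.1) (layerRem RB K t τ) V : ℝ)) K t τ)
      Bad Cc Rr CcRec RrRec ν u s₂ c₀ r s)
    (hr : Summable r) (hu : Summable u) (hs : Summable s) (hs₂ : Summable s₂) :
    ∃ K₀, HybridNE7 l₀ vol (fun K => layerT₂ T₀ m₀ (K₀ + K))
      (fun K => layerX₂ F χ NW₀ m₀ m₀ slot₀ fpol θ₀ vA (fun K => K) RA (K₀ + K))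
      (fun K => layerX₂ F χ NW₀ m₀ m₀ slot₀ fpol θ₀ vB (fun K => K + 1) RB (K₀ + K))
      (fun K => Bad (K₀ + K)) (fun K => W (K₀ + K))
      (fun K => shellW χ (fun _ τ => fieldMeasure (F.P (NW₀ τ.1)) 0 (SU N)) (layerM₂ m₀) (layerSlot₂ slot₀)
        (layerPol₂ m₀ fpol) (layerThr θ₀) (layerVar₂ vA) (layerVar₂ vB)
        (fun K t τ V => (oldDensity F (expMeanLogSU : LoopAverage (SU N)) K (NW₀ τ.1) (layerRem RA K t τ) V : ℝ)) (K₀ + K))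
      (fun K => shellW χ (fun _ τ => fieldMeasure (F.P (NW₀ τ.1)) 0 (SU N)) (layerM₂ m₀) (layerSlot₂ slot₀)
        (layerPol₂ m₀ fpol) (layerThr θ₀) (layerVar₂ vB) (layerVar₂ vA)
        (fun K t τ V => (oldDensity F (expMeanLogSU : LoopAverage (SU N)) (K + 1) (NW₀ τ.1) (layerRem RB K t τ) V : ℝ)) (K₀ + K))
      (fun K => ∑ a ∈ range (N₀ + 1), (n a : ℝ) * lipWeight Lχ (fun _ => 2) (geomWidth C θmin ϑ) a (K₀ + K))
      (fun K => (r (K₀ + K) + u (K₀ + K)) + (s (K₀ + K) + s₂ (K₀ + K))) :=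
  hybridNE7_closure'_tail hW
    (shellWeightBound_patterned_of_localRate F hχ hNW hwin hband hinj hmin hθf hvm hloc hC hϑ0 hϑ1 hR hRA0 hRAi hRB0 hRBi)
    hTB hr hu hs hs₂

/-- **… WITH ROW NE7b's DATUM AT THE OLDER LEVEL** (where NE7b produces it): `RelWeightBound l₀ T₀ fixW^A fixW^B Bad₀ W` on the
FIXED-BLOCK weights of the older histories — exactly the `hW` of pv07's `T4PatternLayer.cauchy_of_finest_patterned` — is
transported to the layer's class «older history in `Bad₀`, any polarity pattern» by neutrality (`relWeightBound_layer₂` with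
`sum_layerOver_layerX₂`); then `hybridNE7_tail_patterned_of_localRate`. [folklore] -/
theorem hybridNE7_tail_patterned_of_localRate_fixW {l₀ vol : ℝ} {T₀ : ℕ → Finset ι₀} {R : Readings Dat Sit} {C ϑ θmin : ℝ}
    {χ : ℕ → ℝ → ℝ} {κ Lχ : ℕ → ℝ} (hχ : ∀ a, LipProfile (χ a) (κ a) (Lχ a)) {N₀ : ℕ} {n : ℕ → ℕ}
    {NW₀ : ι₀ → ℕ} (hNW : ∀ K, ∀ τ' ∈ T₀ K, NW₀ τ' ≤ K) {m₀ : ℕ → ι₀ → ℕ} {slot₀ : ℕ → ι₀ → ℕ → Σ _ : ℕ, ℕ}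
    (hwin : ∀ K, ∀ τ' ∈ T₀ K, ∀ i < m₀ K τ', slot₀ K τ' i ∈ (range (N₀ + 1)).sigma fun a => range (n a))
    (hband : ∀ K, ∀ τ' ∈ T₀ K, ∀ i < m₀ K τ', (slot₀ K τ' i).1 ≤ K)
    (hinj : ∀ K, ∀ τ' ∈ T₀ K, ∀ j < m₀ K τ', ∀ j' < m₀ K τ', slot₀ K τ' j = slot₀ K τ' j' → j = j')
    {fpol : ℕ → ι₀ → ℕ → Pol} {θ₀ : ℕ → ι₀ → ℕ → ℝ} (hmin : 0 < θmin) (hθf : ThresholdFloor T₀ m₀ θ₀ θmin)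
    {vA vB : (K : ℕ) → (τ' : ι₀) → ℕ → GaugeField (F.P (NW₀ τ')) 0 (SU N) → ℝ}
    (hvm : ∀ K, ∀ τ' ∈ T₀ K, ∀ i < m₀ K τ', Measurable (vA K τ' i) ∧ Measurable (vB K τ' i))
    (hloc : LocalRate R C ϑ) (hC : 0 ≤ C) (hϑ0 : 0 ≤ ϑ) (hϑ1 : ϑ < 1)
    (hR : ReadsLevels R T₀ (fun _ τ' => fieldMeasure (F.P (NW₀ τ')) 0 (SU N)) m₀ slot₀ vA vB)
    {RA : (K : ℕ) → ℝ → ι₀ → GaugeField (F.P K) 0 (SU N) → ℝ}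
    {RB : (K : ℕ) → ℝ → ι₀ → GaugeField (F.P (K + 1)) 0 (SU N) → ℝ}
    (hRA0 : ∀ K t, |t| ≤ l₀ → ∀ τ' ∈ T₀ K, 0 ≤ᵐ[fieldMeasure (F.P K) 0 (SU N)] RA K t τ')
    (hRAi : ∀ K t, |t| ≤ l₀ → ∀ τ' ∈ T₀ K, Integrable (RA K t τ') (fieldMeasure (F.P K) 0 (SU N)))
    (hRB0 : ∀ K t, |t| ≤ l₀ → ∀ τ' ∈ T₀ K, 0 ≤ᵐ[fieldMeasure (F.P (K + 1)) 0 (SU N)] RB K t τ')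
    (hRBi : ∀ K t, |t| ≤ l₀ → ∀ τ' ∈ T₀ K, Integrable (RB K t τ') (fieldMeasure (F.P (K + 1)) 0 (SU N)))
    {Bad₀ : ℕ → ℝ → Finset ι₀} {W : ℕ → ℝ}
    (hW : RelWeightBound l₀ T₀ (fixW F χ NW₀ m₀ m₀ slot₀ fpol θ₀ vA (fun K => K) RA)
      (fixW F χ NW₀ m₀ m₀ slot₀ fpol θ₀ vB (fun K => K + 1) RB) Bad₀ W)
    {Cc Rr CcRec RrRec : ℕ → ℝ → ι₀ × Finset ℕ → ℝ} {ν u s₂ c₀ r s : ℕ → ℝ}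
    (hTB : ReindexedBudget l₀ vol (layerT₂ T₀ m₀)
      (fun K t τ => layerX₂ F χ NW₀ m₀ m₀ slot₀ fpol θ₀ vA (fun K => K) RA K t τ -
        shellW χ (fun _ τ => fieldMeasure (F.P (NW₀ τ.1)) 0 (SU N)) (layerM₂ m₀) (layerSlot₂ slot₀) (layerPol₂ m₀ fpol)
          (layerThr θ₀) (layerVar₂ vA) (layerVar₂ vB)
          (fun K t τ V => (oldDensity F (expMeanLogSU : LoopAverage (SU N)) K (NW₀ τ.1) (layerRem RA K t τ) V : ℝ)) K t τ)
      (fun K t τ => layerX₂ F χ NW₀ m₀ m₀ slot₀ fpol θ₀ vB (fun K => K + 1) RB K t τ -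
        shellW χ (fun _ τ => fieldMeasure (F.P (NW₀ τ.1)) 0 (SU N)) (layerM₂ m₀) (layerSlot₂ slot₀) (layerPol₂ m₀ fpol)
          (layerThr θ₀) (layerVar₂ vB) (layerVar₂ vA)
          (fun K t τ V => (oldDensity F (expMeanLogSU : LoopAverage (SU N)) (K + 1) (NW₀ τ.1) (layerRem RB K t τ) V : ℝ)) K t τ)
      (fun K t => layerOver (Bad₀ K t) (m₀ K)) Cc Rr CcRec RrRec ν u s₂ c₀ r s)
    (hr : Summable r) (hu : Summable u) (hs : Summable s) (hs₂ : Summable s₂) :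
    ∃ K₀, HybridNE7 l₀ vol (fun K => layerT₂ T₀ m₀ (K₀ + K))
      (fun K => layerX₂ F χ NW₀ m₀ m₀ slot₀ fpol θ₀ vA (fun K => K) RA (K₀ + K))
      (fun K => layerX₂ F χ NW₀ m₀ m₀ slot₀ fpol θ₀ vB (fun K => K + 1) RB (K₀ + K))
      (fun K => (fun K t => layerOver (Bad₀ K t) (m₀ K)) (K₀ + K)) (fun K => W (K₀ + K))
      (fun K => shellW χ (fun _ τ => fieldMeasure (F.P (NW₀ τ.1)) 0 (SU N)) (layerM₂ m₀) (layerSlot₂ slot₀)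
        (layerPol₂ m₀ fpol) (layerThr θ₀) (layerVar₂ vA) (layerVar₂ vB)
        (fun K t τ V => (oldDensity F (expMeanLogSU : LoopAverage (SU N)) K (NW₀ τ.1) (layerRem RA K t τ) V : ℝ)) (K₀ + K))
      (fun K => shellW χ (fun _ τ => fieldMeasure (F.P (NW₀ τ.1)) 0 (SU N)) (layerM₂ m₀) (layerSlot₂ slot₀)
        (layerPol₂ m₀ fpol) (layerThr θ₀) (layerVar₂ vB) (layerVar₂ vA)
        (fun K t τ V => (oldDensity F (expMeanLogSU : LoopAverage (SU N)) (K + 1) (NW₀ τ.1) (layerRem RB K t τ) V : ℝ)) (K₀ + K))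
      (fun K => ∑ a ∈ range (N₀ + 1), (n a : ℝ) * lipWeight Lχ (fun _ => 2) (geomWidth C θmin ϑ) a (K₀ + K))
      (fun K => (r (K₀ + K) + u (K₀ + K)) + (s (K₀ + K) + s₂ (K₀ + K))) := by
  -- NE7b's older-level datum transported to the layer by neutrality (the pattern weights over τ' total fixW τ')
  have hW' : RelWeightBound l₀ (layerT₂ T₀ m₀) (layerX₂ F χ NW₀ m₀ m₀ slot₀ fpol θ₀ vA (fun K => K) RA)
      (layerX₂ F χ NW₀ m₀ m₀ slot₀ fpol θ₀ vB (fun K => K + 1) RB) (fun K t => layerOver (Bad₀ K t) (m₀ K)) W :=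
    relWeightBound_layer₂ hW
      (fun K t ht B' hB' => sum_layerOver_layerX₂ F (fun K => K) hχ (fun _ _ _ => le_rfl) hvm hRAi K ht hB')
      (fun K t ht B' hB' => sum_layerOver_layerX₂ F (fun K => K + 1) hχ (fun _ _ _ => le_rfl)
        (fun K τ hτ i hi => (hvm K τ hτ i hi).symm) hRBi K ht hB')
  exact hybridNE7_tail_patterned_of_localRate F hχ hNW hwin hband hinj hmin hθf hvm hloc hC hϑ0 hϑ1 hR hRA0 hRAi hRB0
    hRBi hW' hTB hr hu hs hs₂

/-! ## The window representations of the layer, by name; END-S with the budget on the common min-cores -/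

section CoreW

variable {l₀ : ℝ} {T₀ : ℕ → Finset ι₀} {χ : ℕ → ℝ → ℝ} {κ Lχ : ℕ → ℝ} {N₀ : ℕ} {n : ℕ → ℕ} {NW₀ : ι₀ → ℕ}
  {m₀ : ℕ → ι₀ → ℕ} {slot₀ : ℕ → ι₀ → ℕ → Σ _ : ℕ, ℕ} {fpol : ℕ → ι₀ → ℕ → Pol} {θ₀ : ℕ → ι₀ → ℕ → ℝ}
  {vA vB : (K : ℕ) → (τ' : ι₀) → ℕ → GaugeField (F.P (NW₀ τ')) 0 (SU N) → ℝ}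
  {RA : (K : ℕ) → ℝ → ι₀ → GaugeField (F.P K) 0 (SU N) → ℝ}
  {RB : (K : ℕ) → ℝ → ι₀ → GaugeField (F.P (K + 1)) 0 (SU N) → ℝ}

omit [DecidableEq ι₀] in
/-- **RUN A's WINDOW REPRESENTATION OF THE LAYER** (`T4LipschitzLedger.TermRepr` on the common `K`-free window of depth `NW₀ τ.1`,
remainder = the old density of the older history's weight): `termRepr_layer₂_A` transported by `termRepr_window_of_finest_A` —
the first two lines of END-W, exposed by name. [folklore] -/
theorem termRepr_window_layer_A (hχ : ∀ a, LipProfile (χ a) (κ a) (Lχ a)) (hNW : ∀ K, ∀ τ' ∈ T₀ K, NW₀ τ' ≤ K)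
    (hwin : ∀ K, ∀ τ' ∈ T₀ K, ∀ i < m₀ K τ', slot₀ K τ' i ∈ (range (N₀ + 1)).sigma fun a => range (n a))
    (hband : ∀ K, ∀ τ' ∈ T₀ K, ∀ i < m₀ K τ', (slot₀ K τ' i).1 ≤ K)
    (hθ : ∀ K, ∀ τ' ∈ T₀ K, ∀ i < m₀ K τ', 0 < θ₀ K τ' i)
    (hvm : ∀ K, ∀ τ' ∈ T₀ K, ∀ i < m₀ K τ', Measurable (vA K τ' i) ∧ Measurable (vB K τ' i))
    (hRA0 : ∀ K t, |t| ≤ l₀ → ∀ τ' ∈ T₀ K, 0 ≤ᵐ[fieldMeasure (F.P K) 0 (SU N)] RA K t τ')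
    (hRAi : ∀ K t, |t| ≤ l₀ → ∀ τ' ∈ T₀ K, Integrable (RA K t τ') (fieldMeasure (F.P K) 0 (SU N))) :
    TermRepr l₀ (layerT₂ T₀ m₀) (layerX₂ F χ NW₀ m₀ m₀ slot₀ fpol θ₀ vA (fun K => K) RA) χ κ Lχ N₀ n
      (fun _ τ => fieldMeasure (F.P (NW₀ τ.1)) 0 (SU N)) (layerM₂ m₀) (layerSlot₂ slot₀) (layerPol₂ m₀ fpol) (layerThr θ₀)
      (layerVar₂ vA) (layerVar₂ vB)
      (fun K t τ V => (oldDensity F (expMeanLogSU : LoopAverage (SU N)) K (NW₀ τ.1) (layerRem RA K t τ) V : ℝ)) :=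
  termRepr_window_of_finest_A F (fun τ : ι₀ × Finset ℕ => NW₀ τ.1)
    (fun K τ hτ => hNW K τ.1 (mem_layerT₂.1 hτ).1)
    (fun K τ hτ i hi => hvm K τ.1 (mem_layerT₂.1 hτ).1 i hi)
    (termRepr_layer₂_A F (md := m₀) (fpol := fpol) hχ hθ hwin hband hvm hRA0 hRAi)

omit [DecidableEq ι₀] in
/-- **RUN B's WINDOW REPRESENTATION OF THE LAYER** (cutoff `K + 1`, the roles of `vA`/`vB` exchanged). [folklore] -/
theorem termRepr_window_layer_B (hχ : ∀ a, LipProfile (χ a) (κ a) (Lχ a)) (hNW : ∀ K, ∀ τ' ∈ T₀ K, NW₀ τ' ≤ K)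
    (hwin : ∀ K, ∀ τ' ∈ T₀ K, ∀ i < m₀ K τ', slot₀ K τ' i ∈ (range (N₀ + 1)).sigma fun a => range (n a))
    (hband : ∀ K, ∀ τ' ∈ T₀ K, ∀ i < m₀ K τ', (slot₀ K τ' i).1 ≤ K)
    (hθ : ∀ K, ∀ τ' ∈ T₀ K, ∀ i < m₀ K τ', 0 < θ₀ K τ' i)
    (hvm : ∀ K, ∀ τ' ∈ T₀ K, ∀ i < m₀ K τ', Measurable (vA K τ' i) ∧ Measurable (vB K τ' i))
    (hRB0 : ∀ K t, |t| ≤ l₀ → ∀ τ' ∈ T₀ K, 0 ≤ᵐ[fieldMeasure (F.P (K + 1)) 0 (SU N)] RB K t τ')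
    (hRBi : ∀ K t, |t| ≤ l₀ → ∀ τ' ∈ T₀ K, Integrable (RB K t τ') (fieldMeasure (F.P (K + 1)) 0 (SU N))) :
    TermRepr l₀ (layerT₂ T₀ m₀) (layerX₂ F χ NW₀ m₀ m₀ slot₀ fpol θ₀ vB (fun K => K + 1) RB) χ κ Lχ N₀ n
      (fun _ τ => fieldMeasure (F.P (NW₀ τ.1)) 0 (SU N)) (layerM₂ m₀) (layerSlot₂ slot₀) (layerPol₂ m₀ fpol) (layerThr θ₀)
      (layerVar₂ vB) (layerVar₂ vA)
      (fun K t τ V => (oldDensity F (expMeanLogSU : LoopAverage (SU N)) (K + 1) (NW₀ τ.1) (layerRem RB K t τ) V : ℝ)) :=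
  termRepr_window_of_finest_B F (fun τ : ι₀ × Finset ℕ => NW₀ τ.1)
    (fun K τ hτ => Nat.le_succ_of_le (hNW K τ.1 (mem_layerT₂.1 hτ).1))
    (fun K τ hτ i hi => (hvm K τ.1 (mem_layerT₂.1 hτ).1 i hi).symm)
    (termRepr_layer₂_B F (md := m₀) (fpol := fpol) hχ hθ hwin hband (fun K τ hτ i hi => (hvm K τ hτ i hi).symm) hRB0 hRBi)

/-- **END-S WITH THE BUDGET ON THE COMMON MIN-CORES** (the natural object of node U5b's supplier: the two runs' `coreW` share the
min-core integrand `∏ min(χ(u^A/θ), χ(u^B/θ))`, `T4LipschitzLedger.coreW_comm` / `core_sandwich`): a `ReindexedBudget` on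
`coreW^A`, `coreW^B` IS one on the socket's hybrid cores (`reindexedBudget_of_coreW` with the window representations above), then
`hybridNE7_tail_patterned_of_localRate`. [folklore] -/
theorem hybridNE7_tail_patterned_of_localRate_coreW {vol : ℝ} {R : Readings Dat Sit} {C ϑ θmin : ℝ}
    (hχ : ∀ a, LipProfile (χ a) (κ a) (Lχ a)) (hNW : ∀ K, ∀ τ' ∈ T₀ K, NW₀ τ' ≤ K)
    (hwin : ∀ K, ∀ τ' ∈ T₀ K, ∀ i < m₀ K τ', slot₀ K τ' i ∈ (range (N₀ + 1)).sigma fun a => range (n a))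
    (hband : ∀ K, ∀ τ' ∈ T₀ K, ∀ i < m₀ K τ', (slot₀ K τ' i).1 ≤ K)
    (hinj : ∀ K, ∀ τ' ∈ T₀ K, ∀ j < m₀ K τ', ∀ j' < m₀ K τ', slot₀ K τ' j = slot₀ K τ' j' → j = j')
    (hmin : 0 < θmin) (hθf : ThresholdFloor T₀ m₀ θ₀ θmin)
    (hvm : ∀ K, ∀ τ' ∈ T₀ K, ∀ i < m₀ K τ', Measurable (vA K τ' i) ∧ Measurable (vB K τ' i))
    (hloc : LocalRate R C ϑ) (hC : 0 ≤ C) (hϑ0 : 0 ≤ ϑ) (hϑ1 : ϑ < 1)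
    (hR : ReadsLevels R T₀ (fun _ τ' => fieldMeasure (F.P (NW₀ τ')) 0 (SU N)) m₀ slot₀ vA vB)
    (hRA0 : ∀ K t, |t| ≤ l₀ → ∀ τ' ∈ T₀ K, 0 ≤ᵐ[fieldMeasure (F.P K) 0 (SU N)] RA K t τ')
    (hRAi : ∀ K t, |t| ≤ l₀ → ∀ τ' ∈ T₀ K, Integrable (RA K t τ') (fieldMeasure (F.P K) 0 (SU N)))
    (hRB0 : ∀ K t, |t| ≤ l₀ → ∀ τ' ∈ T₀ K, 0 ≤ᵐ[fieldMeasure (F.P (K + 1)) 0 (SU N)] RB K t τ')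
    (hRBi : ∀ K t, |t| ≤ l₀ → ∀ τ' ∈ T₀ K, Integrable (RB K t τ') (fieldMeasure (F.P (K + 1)) 0 (SU N)))
    {Bad : ℕ → ℝ → Finset (ι₀ × Finset ℕ)} {W : ℕ → ℝ}
    (hW : RelWeightBound l₀ (layerT₂ T₀ m₀) (layerX₂ F χ NW₀ m₀ m₀ slot₀ fpol θ₀ vA (fun K => K) RA)
      (layerX₂ F χ NW₀ m₀ m₀ slot₀ fpol θ₀ vB (fun K => K + 1) RB) Bad W)
    {Cc Rr CcRec RrRec : ℕ → ℝ → ι₀ × Finset ℕ → ℝ} {ν u s₂ c₀ r s : ℕ → ℝ}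
    (h : ReindexedBudget l₀ vol (layerT₂ T₀ m₀)
      (coreW χ (fun _ τ => fieldMeasure (F.P (NW₀ τ.1)) 0 (SU N)) (layerM₂ m₀) (layerSlot₂ slot₀) (layerPol₂ m₀ fpol)
        (layerThr θ₀) (layerVar₂ vA) (layerVar₂ vB)
        (fun K t τ V => (oldDensity F (expMeanLogSU : LoopAverage (SU N)) K (NW₀ τ.1) (layerRem RA K t τ) V : ℝ)))
      (coreW χ (fun _ τ => fieldMeasure (F.P (NW₀ τ.1)) 0 (SU N)) (layerM₂ m₀) (layerSlot₂ slot₀) (layerPol₂ m₀ fpol)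
        (layerThr θ₀) (layerVar₂ vB) (layerVar₂ vA)
        (fun K t τ V => (oldDensity F (expMeanLogSU : LoopAverage (SU N)) (K + 1) (NW₀ τ.1) (layerRem RB K t τ) V : ℝ)))
      Bad Cc Rr CcRec RrRec ν u s₂ c₀ r s)
    (hr : Summable r) (hu : Summable u) (hs : Summable s) (hs₂ : Summable s₂) :
    ∃ K₀, HybridNE7 l₀ vol (fun K => layerT₂ T₀ m₀ (K₀ + K))
      (fun K => layerX₂ F χ NW₀ m₀ m₀ slot₀ fpol θ₀ vA (fun K => K) RA (K₀ + K))
      (fun K => layerX₂ F χ NW₀ m₀ m₀ slot₀ fpol θ₀ vB (fun K => K + 1) RB (K₀ + K))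
      (fun K => Bad (K₀ + K)) (fun K => W (K₀ + K))
      (fun K => shellW χ (fun _ τ => fieldMeasure (F.P (NW₀ τ.1)) 0 (SU N)) (layerM₂ m₀) (layerSlot₂ slot₀)
        (layerPol₂ m₀ fpol) (layerThr θ₀) (layerVar₂ vA) (layerVar₂ vB)
        (fun K t τ V => (oldDensity F (expMeanLogSU : LoopAverage (SU N)) K (NW₀ τ.1) (layerRem RA K t τ) V : ℝ)) (K₀ + K))
      (fun K => shellW χ (fun _ τ => fieldMeasure (F.P (NW₀ τ.1)) 0 (SU N)) (layerM₂ m₀) (layerSlot₂ slot₀)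
        (layerPol₂ m₀ fpol) (layerThr θ₀) (layerVar₂ vB) (layerVar₂ vA)
        (fun K t τ V => (oldDensity F (expMeanLogSU : LoopAverage (SU N)) (K + 1) (NW₀ τ.1) (layerRem RB K t τ) V : ℝ)) (K₀ + K))
      (fun K => ∑ a ∈ range (N₀ + 1), (n a : ℝ) * lipWeight Lχ (fun _ => 2) (geomWidth C θmin ϑ) a (K₀ + K))
      (fun K => (r (K₀ + K) + u (K₀ + K)) + (s (K₀ + K) + s₂ (K₀ + K))) :=
  have hθ : ∀ K, ∀ τ' ∈ T₀ K, ∀ i < m₀ K τ', 0 < θ₀ K τ' i := hθf.thr_pos hmin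
  hybridNE7_tail_patterned_of_localRate F hχ hNW hwin hband hinj hmin hθf hvm hloc hC hϑ0 hϑ1 hR hRA0 hRAi hRB0 hRBi hW
    (reindexedBudget_of_coreW (termRepr_window_layer_A F hχ hNW hwin hband hθ hvm hRA0 hRAi)
      (termRepr_window_layer_B F hχ hNW hwin hband hθ hvm hRB0 hRBi) h) hr hu hs hs₂

end CoreW

end Summit.QuantumFields.BalabanUV.T4Continuum.NE7cSmoothingSocket

end
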